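import Literature.AnabelianGeometry.EtaleTheta.ThetaSubquotientOfTemperedPsiTransport
import Literature.AnabelianGeometry.EtaleTheta.ThetaSubquotientLevelN
import Literature.AnabelianGeometry.EtaleTheta.Discharge.Sec5OfConnectedTemperoid

/-!
# [EtTh] Thm 5.6, T56-L03 step 2 (𝔉-level): the Δ-transport `aΨ` of a self-equivalence `Ψ` at the genuine §5 data over `B^temp(Π^tp_X)⁰`
# with `Q := RigidData.levelStub`, and its naturality `haΨn` — the «⊗ ℤ/Nℤ» cast of abc-iut-w5-d013's carrier-level `psiTransport`

Mochizuki, *The étale theta function and its Frobenioid-theoretic manifestations*, Publ. RIMS **45** (2009), Thm. 5.6 proof p. 329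
(PDF p. 103) l.1 («it follows from Propositions 2.4, 2.6 that `Ψ` preserves "`(l·Δ_Θ)_(−)`"»); §5 p. 327 (PDF p. 101).
[cite: MochizukiEtTh2009, Thm 5.6 proof p.329 (PDF p.103)]

abc-iut cell.  CLASS (b) CONSTRUCTION (ONE data def `ThetaFrobenioid.deltaTransport`, a `MulEquiv`; no structure field / instance / notation /
Prop fact) + its laws.  Seat abc-iut-w5-d020 (gen 4, K4 custodian; L2-lead CLAIM 11:40:45Z = abc-iut-w5-d013 g4's released successor row
«T56-L03 step 2 — §5-data plumbing», R299).  The MATHEMATICS is abc-iut-w5-d013's and is consumed BY NAME: `ThetaSubquotient.psiTransport` /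
`psiTransport_apply` / `map_psiTransport` / `psiTransport_autProj` (p442611, over `transportTwist` p440102, `twist` p437689, [SemiAnbd] Prop 3.2
p435495), `ThetaSubquotient.modPowEquiv` / `modPowMap_modPowEquiv` (p440102); the level-`N` parameters `(q_N, ι_N) = (RD.qN ιX, RD.iotaN)` and
`RigidData.levelStub` are abc-iut-w4-d042's (p430659); the genuine §5 data `ofConnectedTemperoidData` are abc-iut-L2-t4's.  What THIS file adds is
the 𝔉-LEVEL CAST that abc-iut-w5-d013's memo (HOME/staging/w5/w5-d013/g4/T56-L03-STEP2-MEMO.md §3) recorded as the default-heartbeat wall: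
it elaborates at DEFAULT heartbeats once (i) every object is spelled `𝔉.base.obj A` (the knit's own spelling of `eΨ`), so that only the stub
projection `𝔉.toThetaSubquotientStub = levelStub` is unfolded, and (ii) intra-file references carry explicit universes (the section's
`V : FrdIMonoidStub.{max u₀ w'}` makes `max ?u ?w =?= max u₀ w'` a non-pattern constraint otherwise) — no `maxHeartbeats` option is used
(L2-lead R299 (a) granted one; not needed).

For `𝔉 := ofConnectedTemperoidData h (RD.levelStub ιX) odd_l R ιX K' …`, a self-equivalence `Ψ` of `C`, its base `Ψbs` with the knit's
identification `eΨ : Ψ ⋙ 𝔉.base ≅ 𝔉.base ⋙ Ψbs`, the [SemiAnbd] Prop 3.2 datum `η : Ψbs ⋙ ι ≅ ι ⋙ B^temp(φ)` and its level-`N` descent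
`(φQ, φΛ, hq, hι)` (abc-iut-w5-d013 p438441 from [EtTh] Cor 2.18 (i)):
* `deltaTransport … A : 𝔉.lDeltaModN A ≃* 𝔉.lDeltaModN (Ψ A)` := `psiTransport` at `(𝔉.base.obj A, 𝔉.base.obj (Ψ A), eΨ_A)` mod `N` —
  the binder `aΨ` of the K4 END KNIT (`Discharge/Sec5Thm56EndKnitOfConnectedTemperoid.lean`, p437581);
* `deltaTransport_mk` — on classes; `deltaTransport_natural` — **the knit's binder `haΨn` is a THEOREM for `aΨ := deltaTransport`**;
* `deltaTransport_mk_autProj` — on the class of `autProj σ` at any `A`: the class of `autProj` of the explicit conjugate of `B^temp(φ)(σ)`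
  (`psiTransport_autProj`) — the entry point of the knit's last γ-input `hT09c` (T56-L09c), whose §5 bookkeeping is the sequel.
(The rfl dictionary `𝔉.lDeltaMap f = map … f.hom` is abc-iut-w4-d042's `ofConnectedTemperoidData_levelN_lDeltaMap`, p432174 — not restated.)

Nothing of [EtTh]'s curves is asserted; the existence of `(φ, η, φQ, φΛ, hq, hι)` for a given `Ψbs` is abc-iut-w5-d013's p435495 + p438441 and
is NOT re-derived here; no side taken on [IUTchIII] Cor. 3.12.
-/

noncomputable section

namespace Literature.AnabelianGeometry.EtaleTheta

namespace ThetaFrobenioid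

open CategoryTheory Opposite Literature.AlgebraicGeometry.Frobenioids Literature.AnabelianGeometry.SemiGraphs
  Literature.AnabelianGeometry.SemiGraphs.GaloisObjects

universe u₀ v₀ w'

variable {K : Type u₀} [Field K] {X : SemiGraphs.TemperedArithmeticGroup.{u₀} K} {D₀ : Type u₀} [Category.{v₀} D₀]
  {V : FrdIMonoidStub.{max u₀ w'}} {T₀ : RealifiedDivisorMonoids (D₀ := D₀) V}
  {VD : FrdICatStub.{u₀ + 1, u₀, max u₀ w'} (ConnectedPart (BTemp X.Pi))}
  {tf : TemperedFrobenioid T₀ (ConnectedPart (BTemp X.Pi)) VD} {hZ : tf.monoidType = MonoidType.Z}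
  {hP : ∀ A : (ConnectedPart (BTemp X.Pi))ᵒᵖ, IsPerfect (tf.Φ.carrier A)}
  {NH : Subgroup (Field.absoluteGaloisGroup K) → tf.category → ℕ+ → Prop} {A₀ : tf.category}
  {hA₀ : PreFrobenioid.IsFrobeniusTrivial tf.toElem A₀} {hA₀' : SemiGraphs.IsGaloisObj A₀.base.obj}
  {lv N : ℕ+} {l' : ℕ} {RD : RigidData.{max u₀ w'} N l'}
  {pullFrac : ∀ {A A' : (BiKummerSetting.mkOfConnectedTemperoid X tf hZ hP NH A₀ hA₀ hA₀').C} (_ : A' ⟶ A),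
    (BiKummerSetting.mkOfConnectedTemperoid X tf hZ hP NH A₀ hA₀ hA₀').biratUnits A →
      (BiKummerSetting.mkOfConnectedTemperoid X tf hZ hP NH A₀ hA₀ hA₀').biratUnits A'}
  {θ : (BiKummerSetting.mkOfConnectedTemperoid X tf hZ hP NH A₀ hA₀ hA₀').biratUnits
    (BiKummerSetting.mkOfConnectedTemperoid X tf hZ hP NH A₀ hA₀ hA₀').Aodot}
  {Bl : (BiKummerSetting.mkOfConnectedTemperoid X tf hZ hP NH A₀ hA₀ hA₀').C}
  {Pl : (BiKummerSetting.mkOfConnectedTemperoid X tf hZ hP NH A₀ hA₀ hA₀').FractionPair θ Bl}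
  {Rl : (BiKummerSetting.mkOfConnectedTemperoid X tf hZ hP NH A₀ hA₀ hA₀').NthRoot θ Pl lv pullFrac}
  (ιX : RD.PiX ≃ₜ* X.Pi) [RD.iotaN.range.Normal]
  (h : ModelFrobenioid.Hypotheses tf.divisorMonoid tf.ratFnFunctor) (odd_l : Odd (lv : ℕ))
  (R : (BiKummerSetting.mkOfConnectedTemperoid X tf hZ hP NH A₀ hA₀ hA₀').NthRoot Rl.root Rl.pair N pullFrac)
  (K' : Type (max u₀ w')) [Field K'] (constEmb : K'ˣ →* tf.biratUnitsModel R.BN)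
  (constEmb_injective : Function.Injective constEmb)
  (hinvc : ∀ g : Aut R.AN.base,
    pull tf.divisorMonoid g.hom (ModelFrobenioid.div R.pair.num) = ModelFrobenioid.div R.pair.num)
  (hinvp : ∀ y : RD.PiX, y ∈ RD.PiYdd →
    pull tf.divisorMonoid ((BiKummerSetting.mkOfConnectedTemperoid X tf hZ hP NH A₀ hA₀ hA₀').galoisSurj R.AN.base
      R.αData.isGalois (ιX y)).hom (ModelFrobenioid.div R.pair.den) = ModelFrobenioid.div R.pair.den)
  -- the self-equivalence, its base, and the identification of the knit
  (Ψ : (BiKummerSetting.mkOfConnectedTemperoid X tf hZ hP NH A₀ hA₀ hA₀').C ≌ (BiKummerSetting.mkOfConnectedTemperoid X tf hZ hP NH A₀ hA₀ hA₀').C)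
  (Ψbs : ConnectedPart (BTemp X.Pi) ⥤ ConnectedPart (BTemp X.Pi))
  (eΨ : Ψ.functor ⋙ (ofConnectedTemperoidData h (RD.levelStub ιX) odd_l R ιX K' constEmb constEmb_injective hinvc hinvp).base ≅
    (ofConnectedTemperoidData h (RD.levelStub ιX) odd_l R ιX K' constEmb constEmb_injective hinvc hinvp).base ⋙ Ψbs)
  -- the [SemiAnbd] Prop 3.2 datum of `Ψ^bs` and its level-`N` descent (abc-iut-w5-d013 p435495 / p438441)
  (φ : X.Pi ≃ₜ* X.Pi) (η : Ψbs ⋙ (connectedObjects (BTemp X.Pi)).ι ≅ (connectedObjects (BTemp X.Pi)).ι ⋙ BTemp.res (φ : X.Pi →ₜ* X.Pi))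
  (φQ : RD.LevelQuot ≃* RD.LevelQuot) (φΛ : RD.mu ≃* RD.mu) (hq : ∀ g : X.Pi, RD.qN ιX (φ g) = φQ (RD.qN ιX g))
  (hι : ∀ a : RD.mu, RD.iotaN (φΛ a) = φQ (RD.iotaN a))

/-- **The Δ-transport `aΨ` of [EtTh] Thm. 5.6 at the genuine §5 data with `Q := levelStub`** («`Ψ` preserves `(l·Δ_Θ)_(−)`», p.329 l.1):
abc-iut-w5-d013's `psiTransport` at `(𝔉.base.obj A, 𝔉.base.obj (Ψ A), eΨ_A)`, mod `N`.  [cite: MochizukiEtTh2009, Thm 5.6 proof p.329 (PDF p.103)] -/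
def deltaTransport (A : (BiKummerSetting.mkOfConnectedTemperoid X tf hZ hP NH A₀ hA₀ hA₀').C) :
    (ofConnectedTemperoidData h (RD.levelStub ιX) odd_l R ιX K' constEmb constEmb_injective hinvc hinvp).lDeltaModN A ≃*
      (ofConnectedTemperoidData h (RD.levelStub ιX) odd_l R ιX K' constEmb constEmb_injective hinvc hinvp).lDeltaModN (Ψ.functor.obj A) :=
  ThetaSubquotient.modPowEquiv
    (ThetaSubquotient.psiTransport (RD.qN ιX) RD.iotaN φ φQ φΛ hq hι Ψbs η
      ((ofConnectedTemperoidData h (RD.levelStub ιX) odd_l R ιX K' constEmb constEmb_injective hinvc hinvp).base.obj A)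
      ((ofConnectedTemperoidData h (RD.levelStub ιX) odd_l R ιX K' constEmb constEmb_injective hinvc hinvp).base.obj (Ψ.functor.obj A)) (eΨ.app A)) N

/-- `deltaTransport` on classes. [cite: MochizukiEtTh2009, Thm 5.6 proof p.329 (PDF p.103)] -/
theorem deltaTransport_mk (A : (BiKummerSetting.mkOfConnectedTemperoid X tf hZ hP NH A₀ hA₀ hA₀').C)
    (y : (ofConnectedTemperoidData h (RD.levelStub ιX) odd_l R ιX K' constEmb constEmb_injective hinvc hinvp).lDeltaObj A) :
    deltaTransport.{u₀, v₀, w'} ιX h odd_l R K' constEmb constEmb_injective hinvc hinvp Ψ Ψbs eΨ φ η φQ φΛ hq hι A (QuotientGroup.mk y) =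
      QuotientGroup.mk (ThetaSubquotient.psiTransport (RD.qN ιX) RD.iotaN φ φQ φΛ hq hι Ψbs η
        ((ofConnectedTemperoidData h (RD.levelStub ιX) odd_l R ιX K' constEmb constEmb_injective hinvc hinvp).base.obj A)
        ((ofConnectedTemperoidData h (RD.levelStub ιX) odd_l R ιX K' constEmb constEmb_injective hinvc hinvp).base.obj (Ψ.functor.obj A)) (eΨ.app A) y) := rfl

/-- **NATURALITY of `aΨ := deltaTransport` in the binder shape `haΨn` of the K4 END KNIT** (p437581): for `f : A → A′`,
`aΨ A′ (((l·Δ_Θ) ⊗ ℤ/Nℤ)(f) x) = ((l·Δ_Θ) ⊗ ℤ/Nℤ)(Ψ f) (aΨ A x)` — abc-iut-w5-d013's `map_psiTransport` (naturality square of `eΨ`) mod `N`.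
[cite: MochizukiEtTh2009, Thm 5.6 proof p.329 (PDF p.103)] -/
theorem deltaTransport_natural {A A' : (BiKummerSetting.mkOfConnectedTemperoid X tf hZ hP NH A₀ hA₀ hA₀').C} (f : A ⟶ A')
    (x : (ofConnectedTemperoidData h (RD.levelStub ιX) odd_l R ιX K' constEmb constEmb_injective hinvc hinvp).lDeltaModN A) :
    deltaTransport.{u₀, v₀, w'} ιX h odd_l R K' constEmb constEmb_injective hinvc hinvp Ψ Ψbs eΨ φ η φQ φΛ hq hι A'
        ((ofConnectedTemperoidData h (RD.levelStub ιX) odd_l R ιX K' constEmb constEmb_injective hinvc hinvp).lDeltaModNMap f x) =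
      (ofConnectedTemperoidData h (RD.levelStub ιX) odd_l R ιX K' constEmb constEmb_injective hinvc hinvp).lDeltaModNMap (Ψ.functor.map f)
        (deltaTransport.{u₀, v₀, w'} ιX h odd_l R K' constEmb constEmb_injective hinvc hinvp Ψ Ψbs eΨ φ η φQ φΛ hq hι A x) := by
  -- the naturality square of `eΨ` at `f`, in the shape `e.inv ≫ gb = F.map fb ≫ e'.inv` of `map_psiTransport`
  have hsq : (eΨ.app A).inv ≫ (ofConnectedTemperoidData h (RD.levelStub ιX) odd_l R ιX K' constEmb constEmb_injective hinvc hinvp).base.map (Ψ.functor.map f) =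
      Ψbs.map ((ofConnectedTemperoidData h (RD.levelStub ιX) odd_l R ιX K' constEmb constEmb_injective hinvc hinvp).base.map f) ≫ (eΨ.app A').inv :=
    (eΨ.inv.naturality f).symm
  have hcar := fun y => ThetaSubquotient.map_psiTransport (RD.qN ιX) RD.iotaN φ φQ φΛ hq hι Ψbs η (eΨ.app A) (eΨ.app A')
    ((ofConnectedTemperoidData h (RD.levelStub ιX) odd_l R ιX K' constEmb constEmb_injective hinvc hinvp).base.map f)
    ((ofConnectedTemperoidData h (RD.levelStub ιX) odd_l R ιX K' constEmb constEmb_injective hinvc hinvp).base.map (Ψ.functor.map f)) hsq y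
  have H := ThetaSubquotient.modPowMap_modPowEquiv
    (ThetaSubquotient.psiTransport (RD.qN ιX) RD.iotaN φ φQ φΛ hq hι Ψbs η
      ((ofConnectedTemperoidData h (RD.levelStub ιX) odd_l R ιX K' constEmb constEmb_injective hinvc hinvp).base.obj A)
      ((ofConnectedTemperoidData h (RD.levelStub ιX) odd_l R ιX K' constEmb constEmb_injective hinvc hinvp).base.obj (Ψ.functor.obj A)) (eΨ.app A))
    (ThetaSubquotient.psiTransport (RD.qN ιX) RD.iotaN φ φQ φΛ hq hι Ψbs η
      ((ofConnectedTemperoidData h (RD.levelStub ιX) odd_l R ιX K' constEmb constEmb_injective hinvc hinvp).base.obj A')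
      ((ofConnectedTemperoidData h (RD.levelStub ιX) odd_l R ιX K' constEmb constEmb_injective hinvc hinvp).base.obj (Ψ.functor.obj A')) (eΨ.app A'))
    ((ofConnectedTemperoidData h (RD.levelStub ιX) odd_l R ιX K' constEmb constEmb_injective hinvc hinvp).lDeltaMap
      ((ofConnectedTemperoidData h (RD.levelStub ιX) odd_l R ιX K' constEmb constEmb_injective hinvc hinvp).base.map f))
    ((ofConnectedTemperoidData h (RD.levelStub ιX) odd_l R ιX K' constEmb constEmb_injective hinvc hinvp).lDeltaMap
      ((ofConnectedTemperoidData h (RD.levelStub ιX) odd_l R ιX K' constEmb constEmb_injective hinvc hinvp).base.map (Ψ.functor.map f)))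
    hcar N x
  exact H.symm

/-- **`aΨ` on the class of a point of print's `Aut`-subquotient** (the entry point of the knit's last γ-input `hT09c`, T56-L09c): for
`σ ∈ autPre (𝔉.base.obj A)`, `aΨ A [autProj σ] = [autProj ((eΨ_A)⁻¹ · η⁻¹ · B^temp(φ)(σ) · η · eΨ_A)]` — abc-iut-w5-d013's
`psiTransport_autProj` mod `N`.  [cite: MochizukiEtTh2009, Thm 5.6 proof p.329 (PDF p.103)] -/
theorem deltaTransport_mk_autProj (A : (BiKummerSetting.mkOfConnectedTemperoid X tf hZ hP NH A₀ hA₀ hA₀').C)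
    (σ : ThetaSubquotient.autPre (RD.qN ιX) RD.iotaN
      ((ofConnectedTemperoidData h (RD.levelStub ιX) odd_l R ιX K' constEmb constEmb_injective hinvc hinvp).base.obj A).obj) :
    deltaTransport.{u₀, v₀, w'} ιX h odd_l R K' constEmb constEmb_injective hinvc hinvp Ψ Ψbs eΨ φ η φQ φΛ hq hι A
        (QuotientGroup.mk (ThetaSubquotient.autProj (RD.qN ιX) RD.iotaN _ σ)) =
      QuotientGroup.mk (ThetaSubquotient.autProj (RD.qN ιX) RD.iotaN
        ((ofConnectedTemperoidData h (RD.levelStub ιX) odd_l R ιX K' constEmb constEmb_injective hinvc hinvp).base.obj (Ψ.functor.obj A)).obj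
        ⟨((connectedObjects (BTemp X.Pi)).ι.mapIso (eΨ.app A).symm).conjAut
            ((η.app ((ofConnectedTemperoidData h (RD.levelStub ιX) odd_l R ιX K' constEmb constEmb_injective hinvc hinvp).base.obj A)).symm.conjAut
              ((BTemp.res (φ : X.Pi →ₜ* X.Pi)).mapIso (σ : Aut ((ofConnectedTemperoidData h (RD.levelStub ιX) odd_l R ιX K' constEmb constEmb_injective hinvc hinvp).base.obj A).obj))),
          ThetaSubquotient.conjAut_mem_autPre (RD.qN ιX) RD.iotaN _
            (ThetaSubquotient.conjAut_mem_autPre (RD.qN ιX) RD.iotaN _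
              (ThetaSubquotient.mapIso_res_mem_autPre (RD.qN ιX) RD.iotaN φ φQ φΛ hq hι _ σ.2))⟩) := by
  rw [deltaTransport_mk.{u₀, v₀, w'}]
  exact congrArg QuotientGroup.mk
    (ThetaSubquotient.psiTransport_autProj (RD.qN ιX) RD.iotaN φ φQ φΛ hq hι Ψbs η
      ((ofConnectedTemperoidData h (RD.levelStub ιX) odd_l R ιX K' constEmb constEmb_injective hinvc hinvp).base.obj A)
      ((ofConnectedTemperoidData h (RD.levelStub ιX) odd_l R ιX K' constEmb constEmb_injective hinvc hinvp).base.obj (Ψ.functor.obj A)) (eΨ.app A) σ)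

end ThetaFrobenioid

end Literature.AnabelianGeometry.EtaleTheta

end
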